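/-
Copyright (c) 2026 the pub-hodgecm-mathlib formalisation cell (harness21).  Prover seat hodgecm-mathlib-K2E4-p11 (g8): Track B «K2-LIT»,
#184♮ = hLiu418 = stmt-HodgeConjecture-24832; socket #41 open surface (u-0c) — file I4, EDITION 4 «DATUM INSTANTIATION `K_H := 𝒦.K`» as a NEW file
(LEAD F0P6-plan (g14) BATCH #56 ∕ #58 (v); desk K2E5-p17 (g8)).  THEOREMS ONLY (no `def`, no `instance`, no `notation`, no named-fact hypothesis, no `sorry`).
-/
import Summits.HodgeConjecture.HodgeConjecture.Theorems.K2LiuSiegelEisensteinMiddleTermContinuous     -- ★ p861968 (this lineage) ED. 2 `exists_middleTerm_package'`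
import Summits.HodgeConjecture.HodgeConjecture.Theorems.K2LiuSiegelMiddleTermIdentification          -- ★ p862046 (this lineage) ED. 3 `middleTerm_eq_tsum_untwisted`, `xi_det_map_eq_one`
import Summits.HodgeConjecture.HodgeConjecture.Theorems.K2LiuSiegelMiddleTermKTypes                  -- ★ I3 p861665 `exists_KTypes_package`
import Summits.HodgeConjecture.HodgeConjecture.Theorems.K2LiuSiegelMiddleTermInnerKTypeOfStandard   -- ★ p862178 (K2Liu-p25) `exists_KHType_of_standard`
import Summits.HodgeConjecture.HodgeConjecture.Theorems.K2LiuSiegelMiddleTermInnerFamily             -- ★ I1 p861931 `innerFamily_torus_law`, `innerFamily_unipotent_law`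
import Summits.HodgeConjecture.HodgeConjecture.Theorems.K2LiuSiegelMiddleTermDetCharacter            -- ★ p862012 `exists_halfNormTwist`, `ha_mul`, `hCa`, `ha_cont`, `ha_lev`
import Summits.HodgeConjecture.HodgeConjecture.Theorems.K2LiuSiegelIwasawaLeviCoordinate             -- ★ I2 p861770 `exists_iwasawaLeviCoordinate`
import Summits.HodgeConjecture.HodgeConjecture.Theorems.K2LiuMiddleTermRowSection                    -- ★ p861585 `exists_rowSection₂`
import Summits.HodgeConjecture.HodgeConjecture.Theorems.K2LiuMiddleInnerSectionHolomorphic           -- ★ (β0-hol) `differentiableOn_phi₂`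
import Summits.HodgeConjecture.HodgeConjecture.Theorems.K2LiuUnipDeltaCornerUnfoldC                  -- ★ C-part p861167 `inner_section_unfold`
import Summits.HodgeConjecture.HodgeConjecture.Theorems.K2LiuModDeltaHeightComparison                -- ★ `exists_modDelta_le_height`, `modDelta_sq_eq_ideleNorm_det`, `exists_height_le_mul_height_mul`
import HarnessLib

/-!
# Crux `HLiu418`, socket #41, (u-0c) FILE I4 ED. 4 — `K2LiuSiegelEisensteinMiddleTermOfStandard`: THE MIDDLE-CELL TERM PACKAGE `E₇` OF A STANDARD FAMILY,
# with the `W`-package, the untwisted inner family `φ` and its five laws, the Iwasawa–Levi coordinate, the row section and the identification `hMID` ALL PAID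
# (`K_H := 𝒦.K`), hypothesis-first on the datum letters, the two (β0-hol) analytic letters and the level letters

Cell `hodgecm-mathlib`, crux item hLiu418 = `stmt-HodgeConjecture-24832`; squad K2 ∕ K2Liu (L1, LEAD F0P6-plan (g14)), road `K2_Liu`, socket #41; desk K2E5-p17 (g8).
Lane `--supports stmt-HodgeConjecture-24832 --as helper` (count-neutral helper; closes no socket by itself).  FRAME `e : Fin N × Fin M ≃ Fin 2` LITERAL (the
currency of every `hMID` payer; the TOP — general `n`, `hn2 : n = 2` — does `subst hn2` and calls this head).

THE MATHEMATICS [MoeglinWaldspurger1995, II.1.7, IV.1.9], [KudlaRallis1994, §2 (2.10)–(2.12)], [Tan1999, §4 Prop. 4.8], [BorelJacquet1979, §4.1].  For `n = 2` the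
middle cell of the constant term of the Siegel Eisenstein series of a STANDARD family `f_s ∈ I_Δ(s, χ)` (`IsStandardSectionFamily 𝒦 χ f`) along `N_Δ` is, in the
Iwasawa–Levi coordinates `h = u·Λ(m_h)·k_h` of `H(𝔸) = P_Δ(𝔸)·K_H`, the `GL₂` Borel Eisenstein sum `Σ'_{p ∈ ℙ¹(L)} φ_s(h; γ̂_p · m_h)` of the UNTWISTED INNER
FAMILY `φ s h g = ξ(det g)⁻¹ · ξ(det m_h) · F_s(Λ g · k_h)` (`ξ = χ·|·|^{½}`, `F_s(y) = ∫ β₁(u) • f_s(w₀·(u·y)) dνN(u)` the inner section of the middle cell); `φ` has the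
flat `GL₂` Borel laws (★ I1), its `K`-restrictions lie in the finite-dimensional flat space `W` generated by the `K_H`-type of `F` (★ I3 over ★ p862178: a standard family
gives `F` a finite `K_H`-type, `K_H := 𝒦.K`), it is holomorphic in `s` (★ (β0-hol)) and of height growth `‖φ s h k‖ ≤ C·‖h‖^A` (the untwisting factor is the
modulus `modDelta(h·k_h⁻¹)`, ★ `exists_modDelta_le_height`), whence ★ (β0-4)′ ∕ ★ ED. 2 `exists_middleTerm_package'` continue `(s − ½)·MID_s(h)` to `{0 < re s}`.
THIS FILE assembles exactly that, BY NAME, over ★ only: §1 the growth of the untwisting factor `b h = ξ(det m_h)`; §2 the Borel laws of `φ` at the datum with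
the Haar measure of `𝔸_{L⁺}` built inside; §3 the `W`-package at `K_H := 𝒦.K` (★ I3 ∘ ★ p862178); §4 the HEAD
**`exists_middleTerm_package_of_standard`** = ★ ED. 2 with its twenty middle letters `W [FinDim] hWstab hWlaw hWlev hWcont hWext φ hφT hφN hφW hφhol hφbd mx hC₀ hA₀
hmx γ hγ c₀ hMID` DISCHARGED (★ I3 ∘ ★ p862178, ★ I1, ★ (β0-hol), §1, ★ I2, ★ `exists_rowSection₂`, `c₀ = 1` ★ ED. 3), the additive Haar measure of `𝔸_{L⁺}` and the
corner line `n₂` built inside (Mathlib `Measure.addHaar`, ★ C-part `inner_section_unfold`), `ξ` built inside (★ `exists_halfNormTwist`).  VISIBLE LETTERS (by value,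
each constructible or a named debt): the carrier `νN β hβ hβtop K hK hβK`, `wq hwq`, `χ hχ hχc` (`hχc`: ★ `toHeckeCharacter_inv_conj_mul_self_eq_one` at the TOP),
`𝒦 f hstd hcont`, the DATUM of ★ α3-2 `g₀ hg₀ Λ hΛ Γ₀ hΓ₀ β₁ hβ₁` with the chart letters `hΛc` (continuity) and `hΛK : Λ(K_{GL₂}) ⊆ 𝒦.K` (I3's own binder — the tie
of the Levi chart to the Iwasawa datum), the inner section `F hF` with the two (β0-hol) ANALYTIC LETTERS `hint` (integrability on `𝒦.K`, `0 < re s`) and `hFhol`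
(holomorphy in `s`), and the LEVEL letters `S γl hγ0 hγ1 hχlev U hUK s₀ hfU hΛU` (conductor of `χ`; a level subgroup `U` of `f_{s₀}` normalised by `𝒦.K` containing
`Λ` of the `GL₂`-level).
HONEST LABEL.  Count-neutral helper; it retires nothing by itself: `HC_CM` is proved only modulo the 7 printed citations (2 remaining named inputs:
hLiu418 = `stmt-HodgeConjecture-24832`, h413 = `stmt-HodgeConjecture-24833`) until rung 0 closes.

## References
* [MoeglinWaldspurger1995] C. Mœglin, J.-L. Waldspurger, *Spectral decomposition and Eisenstein series* (1995), I.2.2, II.1.7, IV.1.9.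
* [KudlaRallis1994] S. Kudla, S. Rallis, *A regularized Siegel–Weil formula: the first term identity*, Ann. of Math. 140 (1994), §2 (2.10)–(2.12).
* [Tan1999] V. Tan, *Poles of Siegel Eisenstein series on U(n,n)*, Canad. J. Math. 51 (1999), §4 Prop. 4.8.
* [BorelJacquet1979] A. Borel, H. Jacquet, *Automorphic forms and automorphic representations*, Corvallis I (1979), §1.2, §4.1.
* [Bump1997] D. Bump, *Automorphic forms and representations* (1997), §3.7.
-/

set_option autoImplicit false
set_option linter.dupNamespace false -- the mandated namespace repeats `HodgeConjecture.HodgeConjecture`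

noncomputable section

open scoped Matrix ENNReal NNReal
open NumberField IsDedekindDomain MeasureTheory MeasureTheory.Measure Filter Set Function Topology Metric
open Literature.NumberTheory.Automorphic Literature.NumberTheory.Automorphic.UnitaryGroup Literature.NumberTheory.GaloisRepresentations
open Literature.NumberTheory.Automorphic.IdeleClassGroup
open Literature.NumberTheory.GelbartRogawski1991 Literature.NumberTheory.GelbartRogawski1991.GRConstruction
open Literature.NumberTheory.GelbartRogawski1991.AdaptedBlocks
open Literature.NumberTheory.K2Lit.SiegelDoubled Literature.MeasureTheory.Group
open UnitaryDualPair
open Summit.HodgeConjecture.HodgeConjecture.Cruxes.HLiu418.K2LiuUnipotentCoveringWeight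
open Summit.HodgeConjecture.HodgeConjecture.Cruxes.HLiu418.K2LiuGL2FlatSectionFiniteData (ofFinite_mem)
open Summit.HodgeConjecture.HodgeConjecture.Cruxes.HLiu418.K2LiuSiegelMiddleCellLeviCriterion (row_ne_zero)
open Summit.HodgeConjecture.HodgeConjecture.Cruxes.HLiu418.K2LiuModDeltaHeightComparison (exists_modDelta_le_height modDelta_sq_eq_ideleNorm_det
  exists_height_le_mul_height_mul)
open Summit.HodgeConjecture.HodgeConjecture.Cruxes.HLiu418.K2LiuMiddleInnerSectionBorelLaw (ideleNorm_coe_pos)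
open Summit.HodgeConjecture.HodgeConjecture.Cruxes.HLiu418.K2LiuUnipDeltaCornerUnfoldC (inner_section_unfold)
open Summit.HodgeConjecture.HodgeConjecture.Cruxes.HLiu418.K2LiuMiddleInnerSectionHolomorphic (differentiableOn_phi₂)
open Summit.HodgeConjecture.HodgeConjecture.Cruxes.HLiu418.K2LiuMiddleTermRowSection (exists_rowSection₂)
open Summit.HodgeConjecture.HodgeConjecture.Cruxes.HLiu418.K2LiuSiegelIwasawaLeviCoordinate (exists_iwasawaLeviCoordinate)
open Summit.HodgeConjecture.HodgeConjecture.Cruxes.HLiu418.K2LiuSiegelMiddleTermDetCharacter (exists_halfNormTwist)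
open Summit.HodgeConjecture.HodgeConjecture.Cruxes.HLiu418.K2LiuSiegelMiddleTermInnerFamily (innerFamily_torus_law innerFamily_unipotent_law)
open Summit.HodgeConjecture.HodgeConjecture.Cruxes.HLiu418.K2LiuSiegelMiddleTermInnerKTypeOfStandard (exists_KHType_of_standard)
open Summit.HodgeConjecture.HodgeConjecture.Cruxes.HLiu418.K2LiuSiegelMiddleTermKTypes (exists_KTypes_package)
open Summit.HodgeConjecture.HodgeConjecture.Cruxes.HLiu418.K2LiuSiegelMiddleTermIdentification (xi_det_map_eq_one middleTerm_eq_tsum_untwisted)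
open Summit.HodgeConjecture.HodgeConjecture.Cruxes.HLiu418.K2LiuSiegelEisensteinMiddleTermContinuous (exists_middleTerm_package')

namespace Summit.HodgeConjecture.HodgeConjecture.Cruxes.HLiu418.K2LiuSiegelEisensteinMiddleTermOfStandard

variable (L : Type) [Field L] [NumberField L] [IsCMField L]
variable {N M : ℕ} (e : Fin N × Fin M ≃ Fin 2)
  (dV : Fin N → L) (hdV : ∀ i, IsCMField.complexConj L (dV i) = dV i)
  (dW : Fin M → L) (hdW : ∀ i, IsCMField.complexConj L (dW i) = dW i)

/-! ## §1 The untwisting factor `b h = ξ(det m_h)` has height growth -/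

/-- **`‖ξ(det m_h)‖ = modDelta(h·k_h⁻¹) ≤ C·‖h‖^A`** for `ξ = χ·|·|^{½}` with `χ` unitary and the Iwasawa–Levi coordinate `m_h = (h·k_h⁻¹)|_Δ`, `k_h ∈ 𝒦.K`:
`‖ξ(d)‖ = |d|_𝔸^{½}`, `|det m_h|_𝔸 = modDelta(h·k_h⁻¹)²` (★ `modDelta_sq_eq_ideleNorm_det`), `modDelta(p) ≤ C·‖p‖^A` on `P_Δ(𝔸)` (★ `exists_modDelta_le_height`) and
`‖h·k_h⁻¹‖ ≤ C_K·‖h‖` on the compact `𝒦.K` (★ `exists_height_le_mul_height_mul`) — the binder `hb` of ★ I3 `exists_KTypes_package` at the datum.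
[cite: MoeglinWaldspurger1995, I.2.2 (vi)–(vii)] [cite: BorelJacquet1979, §1.2] [cite: Bump1997, §3.7] -/
theorem exists_norm_xi_det_levi_le (𝒦 : IwasawaDatum L e dV hdV dW hdW) (χ : HeckeCharacter L) (hχ : χ.IsUnitary) (ξ : (AdeleRing (𝓞 L) L)ˣ →* ℂˣ)
    (hξ : ∀ d : (AdeleRing (𝓞 L) L)ˣ, ((ξ d : ℂˣ) : ℂ) = ((χ d : ℂˣ) : ℂ) * ((IdeleClassGroup.ideleNorm L d : ℝ) : ℂ) ^ (1 / 2 : ℂ))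
    (mx : HA L e dV hdV dW hdW → GL (Fin 2) (AdeleRing (𝓞 L) L)) (kx : HA L e dV hdV dW hdW → HA L e dV hdV dW hdW) (hkx : ∀ h, kx h ∈ 𝒦.K)
    (hp : ∀ h, IsSiegelDelta L e dV hdV dW hdW (h * (kx h)⁻¹))
    (hmx : ∀ h, ((mx h : GL (Fin 2) (AdeleRing (𝓞 L) L)) : Matrix (Fin 2) (Fin 2) (AdeleRing (𝓞 L) L)) = deltaBlock L e dV hdV dW hdW (h * (kx h)⁻¹)) :
    ∃ Cb Ab : ℝ, 0 ≤ Cb ∧ 0 ≤ Ab ∧ ∀ h : HA L e dV hdV dW hdW,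
      ‖((ξ (Matrix.GeneralLinearGroup.det (mx h)) : ℂˣ) : ℂ)‖ ≤ Cb * adelicHeightGL (2 + 2) L (h : GL (Fin (2 + 2)) (AdeleRing (𝓞 L) L)) ^ Ab := by
  haveI : NeZero (2 : ℕ) := ⟨two_ne_zero⟩
  haveI : NeZero (2 + 2 : ℕ) := ⟨by norm_num⟩
  obtain ⟨C, A, hC, hA, hmod⟩ := exists_modDelta_le_height L e dV hdV dW hdW (n := 2)
  obtain ⟨CK, hCK0, hCK⟩ := exists_height_le_mul_height_mul (N := 2 + 2) (K := L)
    (𝒦.isCompact_K.image (continuous_subtype_val : Continuous fun x : HA L e dV hdV dW hdW => (x : GL (Fin (2 + 2)) (AdeleRing (𝓞 L) L))))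
  refine ⟨C * CK ^ A, A, by positivity, hA, fun h => ?_⟩
  -- `‖ξ(det m_h)‖ = modDelta(h k_h⁻¹)`
  have hN := ideleNorm_coe_pos (Matrix.GeneralLinearGroup.det (mx h))
  have hsq : (IdeleClassGroup.ideleNorm L (Matrix.GeneralLinearGroup.det (mx h)) : ℝ) = modDelta L e dV hdV dW hdW (h * (kx h)⁻¹) ^ 2 := by
    rw [coe_ideleNorm, modDelta_sq_eq_ideleNorm_det L e dV hdV dW hdW (hp h) (hmx h)]
  have hmpos := modDelta_pos L e dV hdV dW hdW (h * (kx h)⁻¹)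
  have hnorm : ‖((ξ (Matrix.GeneralLinearGroup.det (mx h)) : ℂˣ) : ℂ)‖ = modDelta L e dV hdV dW hdW (h * (kx h)⁻¹) := by
    rw [hξ, norm_mul, hχ, one_mul, Complex.norm_cpow_eq_rpow_re_of_pos hN, hsq, show ((1 / 2 : ℂ)).re = 1 / 2 by norm_num, ← Real.sqrt_eq_rpow,
      Real.sqrt_sq hmpos.le]
  -- `modDelta(h k_h⁻¹) ≤ C ‖h k_h⁻¹‖^A ≤ C (C_K ‖h‖)^A`
  have h1 := (hmod _ (hp h)).1
  have h2 := hCK ((h * (kx h)⁻¹ : HA L e dV hdV dW hdW) : GL (Fin (2 + 2)) (AdeleRing (𝓞 L) L)) ((kx h : HA L e dV hdV dW hdW) : GL (Fin (2 + 2)) (AdeleRing (𝓞 L) L))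
    ⟨kx h, hkx h, rfl⟩
  rw [← Subgroup.coe_mul, inv_mul_cancel_right] at h2
  have hx0 : 0 ≤ adelicHeightGL (2 + 2) L ((h * (kx h)⁻¹ : HA L e dV hdV dW hdW) : GL (Fin (2 + 2)) (AdeleRing (𝓞 L) L)) := adelicHeightGL_nonneg _
  have hy0 : 0 ≤ adelicHeightGL (2 + 2) L ((h : HA L e dV hdV dW hdW) : GL (Fin (2 + 2)) (AdeleRing (𝓞 L) L)) := adelicHeightGL_nonneg _
  rw [hnorm]
  calc modDelta L e dV hdV dW hdW (h * (kx h)⁻¹)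
      ≤ C * adelicHeightGL (2 + 2) L ((h * (kx h)⁻¹ : HA L e dV hdV dW hdW) : GL (Fin (2 + 2)) (AdeleRing (𝓞 L) L)) ^ A := h1
    _ ≤ C * (CK * adelicHeightGL (2 + 2) L ((h : HA L e dV hdV dW hdW) : GL (Fin (2 + 2)) (AdeleRing (𝓞 L) L))) ^ A :=
        mul_le_mul_of_nonneg_left (Real.rpow_le_rpow hx0 h2 hA) hC.le
    _ = C * CK ^ A * adelicHeightGL (2 + 2) L ((h : HA L e dV hdV dW hdW) : GL (Fin (2 + 2)) (AdeleRing (𝓞 L) L)) ^ A := by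
        rw [Real.mul_rpow hCK0 hy0]; ring

/-! ## The `n = 2` datum (★ α3-2's variable block VERBATIM) -/

variable [MeasurableSpace (unipDelta L e dV hdV dW hdW)] [BorelSpace (unipDelta L e dV hdV dW hdW)]

variable {g₀ : UnitaryGroup.rationalPair (Fp L) L (IsCMField.complexConj L) N M (Matrix.diagonal dV) (Matrix.diagonal dW)}
  (hg₀ : ((g₀ : GL (Fin N × Fin M) L) : Matrix (Fin N × Fin M) (Fin N × Fin M) L) = Matrix.diagonal (fun k => 1 - 2 * (![0, 1] : Fin 2 → L) (e k)))
  (Λ : GL (Fin 2) (AdeleRing (𝓞 L) L) →* HA L e dV hdV dW hdW)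
  (hΛ : ∀ g : GL (Fin 2) (AdeleRing (𝓞 L) L), blk L e dV hdV dW hdW (Λ g) =
    cayR (AdeleRing (𝓞 L) L) (Fin 2) * Matrix.fromBlocks (g : Matrix (Fin 2) (Fin 2) (AdeleRing (𝓞 L) L)) 0 0
      (((gramR L e dV hdV dW hdW).map ((algebraMap L (AdeleRing (𝓞 L) L)).comp (algebraMap (Fp L) L)))⁻¹ *
        (((g⁻¹ : GL (Fin 2) (AdeleRing (𝓞 L) L)) : Matrix (Fin 2) (Fin 2) (AdeleRing (𝓞 L) L)).map
          (conjAdele (Fp L) L (IsCMField.complexConj L)))ᵀ *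
        (gramR L e dV hdV dW hdW).map ((algebraMap L (AdeleRing (𝓞 L) L)).comp (algebraMap (Fp L) L))) *
      cayRinv (AdeleRing (𝓞 L) L) (Fin 2))
  (Γ₀ : Subgroup (unipDelta L e dV hdV dW hdW))
  (hΓ₀ : ∀ u : unipDelta L e dV hdV dW hdW, u ∈ Γ₀ ↔ (u : HA L e dV hdV dW hdW) ∈ ratH L e dV hdV dW hdW ∧
    IsSiegelDelta L e dV hdV dW hdW (iotaGG L e dV hdV dW hdW (1, UnitaryGroup.rationalPairToAdelic (Fp L) L (IsCMField.complexConj L) N M (Matrix.diagonal dV) (Matrix.diagonal dW) g₀) * (u : HA L e dV hdV dW hdW) * (iotaGG L e dV hdV dW hdW (1, UnitaryGroup.rationalPairToAdelic (Fp L) L (IsCMField.complexConj L) N M (Matrix.diagonal dV) (Matrix.diagonal dW) g₀))⁻¹))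
  (wq : unipDeltaRat L e dV hdV dW hdW → ratH L e dV hdV dW hdW)
  (hwq : ∀ ν, ((wq ν : ratH L e dV hdV dW hdW) : HA L e dV hdV dW hdW) =
    weylDelta L e dV hdV dW hdW * ((ν : unipDelta L e dV hdV dW hdW) : HA L e dV hdV dW hdW))

/-! ## §2 The Borel laws of the untwisted inner family at the datum, the Haar measure of `𝔸_{L⁺}` built inside -/

include hg₀ hΛ hΓ₀ in
/-- **`hφT` ∧ `hφN` AT THE DATUM WITH NO MEASURE ON `𝔸_{L⁺}` VISIBLE**: for Siegel sections `f_s ∈ I_Δ(s, χ)` (continuous), a `Γ₀`-covering weight `β₁`, the inner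
sections `F_s(y) = ∫ β₁(u) • f_s(w₀·(u·y)) dνN(u)` (`νN` Haar), `χ` trivial on norms, `ξ = χ·|·|^{½}`, and `φ s x g = a g · b x · F_s(Λ g · k_x)` with `a = ξ(det ·)⁻¹`:
the flat torus law `hφT` and the unipotent invariance `hφN` of ★ (β0-4)′ VERBATIM — ★ I1 `innerFamily_torus_law` ∕ `innerFamily_unipotent_law`, whose `hunfold` is
★ C-part `inner_section_unfold` for the additive Haar measure `Measure.addHaar` of `𝔸_{L⁺}` over `borel` (★ `secondCountableTopology_adeleRing`,
★ `locallyCompactSpace_adeleRing'`), all constructed inside. [cite: MoeglinWaldspurger1995, II.1.7] [cite: KudlaRallis1994, §2 (2.10)–(2.12)] [cite: Bump1997, §3.7] -/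
theorem innerFamily_laws (hdV0 : ∀ i, dV i ≠ 0) (hdW0 : ∀ i, dW i ≠ 0)
    (νN : Measure (unipDelta L e dV hdV dW hdW)) [νN.IsHaarMeasure] {β₁ : unipDelta L e dV hdV dW hdW → ℝ≥0∞} (hβ₁ : IsCoveringWeight Γ₀ β₁)
    (χ : HeckeCharacter L)
    (hχc : ∀ d : (AdeleRing (𝓞 L) L)ˣ, χ (Units.map (conjAdele (Fp L) L (IsCMField.complexConj L) : AdeleRing (𝓞 L) L →* AdeleRing (𝓞 L) L) d) * χ d = 1)
    (f : ℂ → HA L e dV hdV dW hdW → ℂ) (hf : ∀ s : ℂ, IsSiegelDeltaSection L e dV hdV dW hdW χ s (f s)) (hfc : ∀ s : ℂ, Continuous (f s))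
    (F : ℂ → HA L e dV hdV dW hdW → ℂ)
    (hF : ∀ (s : ℂ) (x : HA L e dV hdV dW hdW), F s x = ∫ u, (β₁ u).toReal • f s (iotaGG L e dV hdV dW hdW (1, UnitaryGroup.rationalPairToAdelic (Fp L) L (IsCMField.complexConj L) N M (Matrix.diagonal dV) (Matrix.diagonal dW) g₀) * ((u : HA L e dV hdV dW hdW) * x)) ∂νN)
    {X : Type*} (ξ : (AdeleRing (𝓞 L) L)ˣ →* ℂˣ)
    (hξ : ∀ d : (AdeleRing (𝓞 L) L)ˣ, ((ξ d : ℂˣ) : ℂ) = ((χ d : ℂˣ) : ℂ) * ((IdeleClassGroup.ideleNorm L d : ℝ) : ℂ) ^ (1 / 2 : ℂ))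
    (a : GL (Fin 2) (AdeleRing (𝓞 L) L) → ℂ) (ha : ∀ g, a g = (((ξ (Matrix.GeneralLinearGroup.det g))⁻¹ : ℂˣ) : ℂ))
    (b : X → ℂ) (kx : X → HA L e dV hdV dW hdW) (φ : ℂ → X → GL (Fin 2) (AdeleRing (𝓞 L) L) → ℂ) (hφ : ∀ s x g, φ s x g = a g * b x * F s (Λ g * kx x)) :
    (∀ (s : ℂ) (x : X), 0 < s.re → ∀ (d : Fin 2 → (AdeleRing (𝓞 L) L)ˣ) (g : GL (Fin 2) (AdeleRing (𝓞 L) L)),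
      φ s x (glDiagonal 2 (AdeleRing (𝓞 L) L) d * g) =
        ((IdeleClassGroup.ideleNorm L (d 0) : ℝ) : ℂ) ^ (s + 1 / 2) * ((IdeleClassGroup.ideleNorm L (d 1) : ℝ) : ℂ) ^ (-(s + 1 / 2)) * φ s x g) ∧
    (∀ (s : ℂ) (x : X), 0 < s.re → ∀ u g : GL (Fin 2) (AdeleRing (𝓞 L) L), (u : Matrix (Fin 2) (Fin 2) (AdeleRing (𝓞 L) L)) 1 0 = 0 →
      (u : Matrix (Fin 2) (Fin 2) (AdeleRing (𝓞 L) L)) 0 0 = 1 → (u : Matrix (Fin 2) (Fin 2) (AdeleRing (𝓞 L) L)) 1 1 = 1 → φ s x (u * g) = φ s x g) := by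
  -- the additive Haar measure of `𝔸_{L⁺}` over `borel` and the corner line (★ C-part)
  letI : MeasurableSpace (AdeleRing (𝓞 (Fp L)) (Fp L)) := borel _
  haveI : BorelSpace (AdeleRing (𝓞 (Fp L)) (Fp L)) := ⟨rfl⟩
  haveI := secondCountableTopology_adeleRing (Fp L)
  haveI := locallyCompactSpace_adeleRing' (Fp L)
  obtain ⟨n₂, Cu, -, -, -, -, hn₂mem, hn₂X, -, hunf⟩ :=
    inner_section_unfold L e dV hdV dW hdW hg₀ Λ hΛ hdV0 hdW0 νN (Measure.addHaar : Measure (AdeleRing (𝓞 (Fp L)) (Fp L)))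
  have hunfold : ∀ (s : ℂ) (y : HA L e dV hdV dW hdW), F s y = (fun _ : ℂ => ((Cu.toReal : ℝ) : ℂ)) s * ∫ t,
      f s (iotaGG L e dV hdV dW hdW (1, UnitaryGroup.rationalPairToAdelic (Fp L) L (IsCMField.complexConj L) N M (Matrix.diagonal dV) (Matrix.diagonal dW) g₀) *
        n₂ t * y) ∂(Measure.addHaar : Measure (AdeleRing (𝓞 (Fp L)) (Fp L))) :=
    fun s y => (hunf Γ₀ hΓ₀ β₁ hβ₁ χ s (f s) (hf s) (hfc s)).2 (F s) (hF s) y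
  exact ⟨innerFamily_torus_law L e dV hdV dW hdW hg₀ Λ hΛ hdV0 hdW0 (Measure.addHaar : Measure (AdeleRing (𝓞 (Fp L)) (Fp L))) n₂ hn₂mem hn₂X χ hχc f hf F
      (fun _ : ℂ => ((Cu.toReal : ℝ) : ℂ)) hunfold ξ hξ a ha b kx φ hφ,
    innerFamily_unipotent_law L e dV hdV dW hdW hg₀ Λ hΛ hdV0 hdW0 (Measure.addHaar : Measure (AdeleRing (𝓞 (Fp L)) (Fp L))) n₂ hn₂mem hn₂X χ f hf F
      (fun _ : ℂ => ((Cu.toReal : ℝ) : ℂ)) hunfold ξ a ha b kx φ hφ⟩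

/-! ## §3 The `W`-package of `K`-types at the datum (`K_H := 𝒦.K`): ★ I3 over ★ p862178 and §1 -/

omit [BorelSpace (unipDelta L e dV hdV dW hdW)] in
/-- **THE `W`-PACKAGE AND `hφW`, `hφbd` AT THE DATUM `K_H := 𝒦.K`** for a STANDARD family `f` and the untwisted inner family `φ s x g = a g · b x · F_s(Λ g · k_x)`
(`a = ξ(det ·)⁻¹`, `b x = ξ(det m_x)`, `ξ = χ·|·|^{½}` continuous, `χ` unitary; `m_x, k_x` the Iwasawa–Levi coordinate; `Λ` continuous with `Λ(K_{GL₂}) ⊆ 𝒦.K`) with its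
Borel laws `hφT`, `hφN` BY VALUE: the finite `K_H`-type of the inner section `F_s(y) = ∫ β₁(u) • f_s(w₀·(u·y)) dνN(u)` (★ p862178 `exists_KHType_of_standard`, from the
analytic letters `hint`, `hFhol` and the level letters `U hUK s₀ hfU`) feeds ★ I3 `exists_KTypes_package` (letters `ha_mul hCa ha_cont ha_lev` ★ `K2LiuSiegelMiddleTermDetCharacter`,
`hb` §1, `hc_lev` from `hΛU`): ★ (β0-4)′'s binders `W hWstab hWlaw hWlev hWcont hWext hφW hφbd` VERBATIM at `height := ‖·‖_{GL₄(𝔸_L)}`.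
[cite: MoeglinWaldspurger1995, II.1.7, IV.1.9] [cite: Tan1999, §1] [cite: HarrisKudlaSweet1996, (1.15)–(1.17)] [cite: Bump1997, §3.7] -/
theorem exists_KTypes_package_of_standard (𝒦 : IwasawaDatum L e dV hdV dW hdW) {χ : HeckeCharacter L} (hχ : χ.IsUnitary)
    {f : ℂ → HA L e dV hdV dW hdW → ℂ} (hstd : IsStandardSectionFamily 𝒦 χ f) (hcont : ∀ s : ℂ, Continuous (f s))
    (hΛc : Continuous Λ) (hΛK : ∀ k : ↥(standardMaximalCompactGL 2 L), Λ k ∈ 𝒦.K) (ξ : (AdeleRing (𝓞 L) L)ˣ →* ℂˣ)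
    (hξ : ∀ d : (AdeleRing (𝓞 L) L)ˣ, ((ξ d : ℂˣ) : ℂ) = ((χ d : ℂˣ) : ℂ) * ((IdeleClassGroup.ideleNorm L d : ℝ) : ℂ) ^ (1 / 2 : ℂ))
    (hξc : Continuous fun d => ((ξ d : ℂˣ) : ℂ))
    (a : GL (Fin 2) (AdeleRing (𝓞 L) L) → ℂ) (ha : ∀ g, a g = (((ξ (Matrix.GeneralLinearGroup.det g))⁻¹ : ℂˣ) : ℂ))
    (mx : HA L e dV hdV dW hdW → GL (Fin 2) (AdeleRing (𝓞 L) L)) (kx : HA L e dV hdV dW hdW → HA L e dV hdV dW hdW) (hkx : ∀ h, kx h ∈ 𝒦.K)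
    (hp : ∀ h, IsSiegelDelta L e dV hdV dW hdW (h * (kx h)⁻¹))
    (hmx : ∀ h, ((mx h : GL (Fin 2) (AdeleRing (𝓞 L) L)) : Matrix (Fin 2) (Fin 2) (AdeleRing (𝓞 L) L)) = deltaBlock L e dV hdV dW hdW (h * (kx h)⁻¹))
    (b : HA L e dV hdV dW hdW → ℂ) (hb : ∀ x, b x = ((ξ (Matrix.GeneralLinearGroup.det (mx x)) : ℂˣ) : ℂ))
    (νN : Measure (unipDelta L e dV hdV dW hdW)) (β₁ : unipDelta L e dV hdV dW hdW → ℝ≥0∞)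
    (w₀ : HA L e dV hdV dW hdW) (F : ℂ → HA L e dV hdV dW hdW → ℂ)
    (hF : ∀ (s : ℂ) (x : HA L e dV hdV dW hdW), F s x = ∫ u, (β₁ u).toReal • f s (w₀ * ((u : HA L e dV hdV dW hdW) * x)) ∂νN)
    (hint : ∀ s : ℂ, 0 < s.re → ∀ k : HA L e dV hdV dW hdW, k ∈ 𝒦.K →
      Integrable (fun u : unipDelta L e dV hdV dW hdW => (β₁ u).toReal • f s (w₀ * ((u : HA L e dV hdV dW hdW) * k))) νN)
    (hFhol : ∀ y : HA L e dV hdV dW hdW, DifferentiableOn ℂ (fun s => F s y) {s : ℂ | 0 < s.re})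
    (φ : ℂ → HA L e dV hdV dW hdW → GL (Fin 2) (AdeleRing (𝓞 L) L) → ℂ) (hφ : ∀ s x g, φ s x g = a g * b x * F s (Λ g * kx x))
    (hφT : ∀ (s : ℂ) (x : HA L e dV hdV dW hdW), 0 < s.re → ∀ (d : Fin 2 → (AdeleRing (𝓞 L) L)ˣ) (g : GL (Fin 2) (AdeleRing (𝓞 L) L)),
      φ s x (glDiagonal 2 (AdeleRing (𝓞 L) L) d * g) =
      ((IdeleClassGroup.ideleNorm L (d 0) : ℝ) : ℂ) ^ (s + 1 / 2) * ((IdeleClassGroup.ideleNorm L (d 1) : ℝ) : ℂ) ^ (-(s + 1 / 2)) * φ s x g)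
    (hφN : ∀ (s : ℂ) (x : HA L e dV hdV dW hdW), 0 < s.re → ∀ u g : GL (Fin 2) (AdeleRing (𝓞 L) L), (u : Matrix (Fin 2) (Fin 2) (AdeleRing (𝓞 L) L)) 1 0 = 0 →
      (u : Matrix (Fin 2) (Fin 2) (AdeleRing (𝓞 L) L)) 0 0 = 1 → (u : Matrix (Fin 2) (Fin 2) (AdeleRing (𝓞 L) L)) 1 1 = 1 → φ s x (u * g) = φ s x g)
    (S : Finset (HeightOneSpectrum (𝓞 L))) (γl : ∀ v : HeightOneSpectrum (𝓞 L), ValuativeRel.ValueGroupWithZero (v.adicCompletion L))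
    (hχlev : ∀ r : GL (Fin 2) (FiniteAdeleRing (𝓞 L) L), r ∈ glFiniteIntegralLevel 2 L → (∀ v ∈ S, GLn.evalAt 2 L v r ∈ congruenceGL 2 (γl v)) →
      χ (Matrix.GeneralLinearGroup.det (GLn.ofFinite 2 L r)) = 1)
    (U : Subgroup (HA L e dV hdV dW hdW)) (hUK : ∀ k ∈ 𝒦.K, ∀ u ∈ U, k⁻¹ * u * k ∈ U)
    (s₀ : ℂ) (hfU : ∀ (g : HA L e dV hdV dW hdW), ∀ u ∈ U, f s₀ (g * u) = f s₀ g)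
    (hΛU : ∀ r : GL (Fin 2) (FiniteAdeleRing (𝓞 L) L), r ∈ glFiniteIntegralLevel 2 L → (∀ v ∈ S, GLn.evalAt 2 L v r ∈ congruenceGL 2 (γl v)) →
      Λ (GLn.ofFinite 2 L r) ∈ U) :
    ∃ (W : Submodule ℂ (↥(standardMaximalCompactGL 2 L) → ℂ)) (_ : FiniteDimensional ℂ W),
      (∀ B ∈ W, ∀ k₀ : ↥(standardMaximalCompactGL 2 L), (fun k => B (k * k₀)) ∈ W) ∧
      (∀ B ∈ W, ∀ p k : ↥(standardMaximalCompactGL 2 L),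
        ((p : GL (Fin 2) (AdeleRing (𝓞 L) L)) : Matrix (Fin 2) (Fin 2) (AdeleRing (𝓞 L) L)) 1 0 = 0 → B (p * k) = B k) ∧
      (∀ B ∈ W, ∀ (k : ↥(standardMaximalCompactGL 2 L)) (r : GL (Fin 2) (FiniteAdeleRing (𝓞 L) L)) (hr : r ∈ glFiniteIntegralLevel 2 L),
        (∀ v ∈ S, GLn.evalAt 2 L v r ∈ congruenceGL 2 (γl v)) →
        B ⟨(k : GL (Fin 2) (AdeleRing (𝓞 L) L)) * GLn.ofFinite 2 L r, (standardMaximalCompactGL 2 L).mul_mem k.2 (ofFinite_mem hr)⟩ = B k) ∧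
      (∀ B ∈ W, Continuous B) ∧
      (∀ B ∈ W, ∃ bB : ℂ → GL (Fin 2) (AdeleRing (𝓞 L) L) → ℂ,
        (∀ s : ℂ, 0 < s.re → ∀ (d : Fin 2 → (AdeleRing (𝓞 L) L)ˣ) (g : GL (Fin 2) (AdeleRing (𝓞 L) L)),
        bB s (glDiagonal 2 (AdeleRing (𝓞 L) L) d * g) =
        ((IdeleClassGroup.ideleNorm L (d 0) : ℝ) : ℂ) ^ (s + 1 / 2) * ((IdeleClassGroup.ideleNorm L (d 1) : ℝ) : ℂ) ^ (-(s + 1 / 2)) * bB s g) ∧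
        (∀ s : ℂ, 0 < s.re → ∀ u g : GL (Fin 2) (AdeleRing (𝓞 L) L), (u : Matrix (Fin 2) (Fin 2) (AdeleRing (𝓞 L) L)) 1 0 = 0 →
        (u : Matrix (Fin 2) (Fin 2) (AdeleRing (𝓞 L) L)) 0 0 = 1 → (u : Matrix (Fin 2) (Fin 2) (AdeleRing (𝓞 L) L)) 1 1 = 1 → bB s (u * g) = bB s g) ∧
        (∀ s : ℂ, 0 < s.re → ∀ (k : GL (Fin 2) (AdeleRing (𝓞 L) L)) (hk : k ∈ standardMaximalCompactGL 2 L), bB s k = B ⟨k, hk⟩)) ∧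
      (∀ (s : ℂ) (x : HA L e dV hdV dW hdW), 0 < s.re → (fun k : ↥(standardMaximalCompactGL 2 L) => φ s x k) ∈ W) ∧
      (∀ z : ℂ, 0 < z.re → ∃ C A r : ℝ, 0 ≤ C ∧ 0 ≤ A ∧ 0 < r ∧ ∀ s : ℂ, dist s z < r →
        ∀ (x : HA L e dV hdV dW hdW) (k : ↥(standardMaximalCompactGL 2 L)), ‖φ s x k‖ ≤ C * adelicHeightGL (2 + 2) L (x : GL (Fin (2 + 2)) (AdeleRing (𝓞 L) L)) ^ A) := by
  -- the growth of `b` (§1)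
  obtain ⟨Cb, Ab, -, hAb, hbH⟩ := exists_norm_xi_det_levi_le L e dV hdV dW hdW 𝒦 χ hχ ξ hξ mx kx hkx hp hmx
  have hbH' : ∀ x : HA L e dV hdV dW hdW, ‖b x‖ ≤ Cb * (fun x : HA L e dV hdV dW hdW => adelicHeightGL (2 + 2) L (x : GL (Fin (2 + 2)) (AdeleRing (𝓞 L) L))) x ^ Ab :=
    fun x => by rw [hb]; exact hbH x
  -- the finite `K_H`-type of the inner section (★ p862178)
  obtain ⟨ι, _, c, Mc, G, hcM, hFK, hG, hccont, ⟨Cc, hCc⟩, ⟨CM, hCM⟩, hclev⟩ := exists_KHType_of_standard 𝒦 hstd s₀ (hcont s₀) νN β₁ w₀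
    (fun u : unipDelta L e dV hdV dW hdW => (u : HA L e dV hdV dW hdW)) F hF hint (fun k _ => (hFhol k).continuousOn) U hUK hfU
  -- ★ I3 at `K_H := 𝒦.K`
  exact exists_KTypes_package S γl
    (fun x : HA L e dV hdV dW hdW => adelicHeightGL (2 + 2) L (x : GL (Fin (2 + 2)) (AdeleRing (𝓞 L) L))) (fun x => adelicHeightGL_pos_holds _)
    𝒦.K F a b Λ kx φ hφ hφT hφN hΛK (fun k k₀ => by rw [Subgroup.coe_mul, map_mul]) hkx c Mc G hcM hFK hG
    (K2LiuSiegelMiddleTermDetCharacter.ha_cont ξ a ha hξc) (fun l => (hccont l).comp (hΛc.comp continuous_subtype_val))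
    (K2LiuSiegelMiddleTermDetCharacter.ha_mul ξ a ha) (K2LiuSiegelMiddleTermDetCharacter.hCa ξ a ha χ hχ hξ) (fun l k => hCc l (Λ k) (hΛK k))
    (fun j l k₁ hk₁ => hCM j l k₁ hk₁) hAb hbH' (K2LiuSiegelMiddleTermDetCharacter.ha_lev ξ a ha χ hξ S γl hχlev)
    (fun l k r hr hrS => by rw [map_mul]; exact hclev l (Λ k) _ (hΛU r hr hrS))

/-! ## §4 HEAD: the middle-cell term package of a standard family -/

set_option maxHeartbeats 400000 in
include hg₀ hΛ hΓ₀ hwq in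
/-- **(u-0c) I4, ED. 4 — THE MIDDLE-CELL TERM PACKAGE `E₇` OF A STANDARD FAMILY (`n = 2`, `K_H := 𝒦.K`).**  Carrier `νN` (Haar on `N_Δ(𝔸)`), `β` an `N_Δ(L⁺)`-covering
weight with `∫⁻β < ∞`, `β ≤ 𝟙_K`, `K` compact; the rational Weyl presentation `wq`; `χ` unitary and trivial on norms (`hχc`); `f` STANDARD for `𝒦` with continuous members;
the DATUM of ★ α3-2 (`g₀`, the Levi chart `Λ` — continuous, with `Λ(K_{GL₂}) ⊆ 𝒦.K` —, the stabiliser lattice `Γ₀` and a `Γ₀`-covering weight `β₁`); the inner section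
`F_s(y) = ∫ β₁(u) • f_s(w₀·(u·y)) dνN(u)` BY VALUE with its two (β0-hol) analytic letters (`hint`: `νN`-integrability on `𝒦.K` for `0 < re s`; `hFhol`: holomorphy in `s` on
`{0 < re}`); the level letters (`S γl hγ0 hγ1`, the conductor letter `hχlev` of `χ`, a level subgroup `U` of `f_{s₀}` normalised by `𝒦.K` containing `Λ` of the `GL₂`-level):
**there is `E₇` with ★ ED. 2's `h7d`, `h7c`, `h7eq` (at `P = {½}`) and `h7g`** — ★ ED. 2 `exists_middleTerm_package'` with `W…`, `φ…`, `mx…`, `γ hγ`, `c₀ = 1`, `hMID` PAID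
(★ I3 ∘ ★ p862178, ★ I1, ★ (β0-hol) `differentiableOn_phi₂`, §1, ★ I2, ★ `exists_rowSection₂`, ★ ED. 3 `middleTerm_eq_tsum_untwisted`; `μ`, `n₂`, `ξ` built inside).
[cite: MoeglinWaldspurger1995, II.1.7, IV.1.9] [cite: KudlaRallis1994, §2 (2.10)–(2.12)] [cite: Tan1999, §4 Prop. 4.8] [cite: BorelJacquet1979, §4.1] -/
theorem exists_middleTerm_package_of_standard (hdV0 : ∀ i, dV i ≠ 0) (hdW0 : ∀ i, dW i ≠ 0)
    -- the carrier
    (νN : Measure (unipDelta L e dV hdV dW hdW)) [νN.IsHaarMeasure]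
    (β : unipDelta L e dV hdV dW hdW → ℝ≥0∞) (hβ : IsCoveringWeight (unipDeltaRat L e dV hdV dW hdW) β) (hβtop : ∫⁻ u, β u ∂νN ≠ ∞)
    {K : Set (unipDelta L e dV hdV dW hdW)} (hK : IsCompact K) (hβK : ∀ u, β u ≤ K.indicator 1 u)
    -- the character and the standard family
    {χ : HeckeCharacter L} (hχ : χ.IsUnitary)
    (hχc : ∀ d : (AdeleRing (𝓞 L) L)ˣ, χ (Units.map (conjAdele (Fp L) L (IsCMField.complexConj L) : AdeleRing (𝓞 L) L →* AdeleRing (𝓞 L) L) d) * χ d = 1)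
    (𝒦 : IwasawaDatum L e dV hdV dW hdW) (f : ℂ → HA L e dV hdV dW hdW → ℂ) (hstd : IsStandardSectionFamily 𝒦 χ f) (hcont : ∀ s : ℂ, Continuous (f s))
    -- the chart letters of the datum
    (hΛc : Continuous Λ) (hΛK : ∀ k : ↥(standardMaximalCompactGL 2 L), Λ k ∈ 𝒦.K)
    {β₁ : unipDelta L e dV hdV dW hdW → ℝ≥0∞} (hβ₁ : IsCoveringWeight Γ₀ β₁)
    -- the inner section of the middle cell, by value, with its two (β0-hol) analytic letters
    (F : ℂ → HA L e dV hdV dW hdW → ℂ)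
    (hF : ∀ (s : ℂ) (x : HA L e dV hdV dW hdW), F s x = ∫ u, (β₁ u).toReal • f s (iotaGG L e dV hdV dW hdW (1, UnitaryGroup.rationalPairToAdelic (Fp L) L (IsCMField.complexConj L) N M (Matrix.diagonal dV) (Matrix.diagonal dW) g₀) * ((u : HA L e dV hdV dW hdW) * x)) ∂νN)
    (hint : ∀ s : ℂ, 0 < s.re → ∀ k : HA L e dV hdV dW hdW, k ∈ 𝒦.K →
      Integrable (fun u : unipDelta L e dV hdV dW hdW => (β₁ u).toReal • f s (iotaGG L e dV hdV dW hdW (1, UnitaryGroup.rationalPairToAdelic (Fp L) L (IsCMField.complexConj L) N M (Matrix.diagonal dV) (Matrix.diagonal dW) g₀) * ((u : HA L e dV hdV dW hdW) * k))) νN)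
    (hFhol : ∀ y : HA L e dV hdV dW hdW, DifferentiableOn ℂ (fun s => F s y) {s : ℂ | 0 < s.re})
    -- the level letters
    (S : Finset (HeightOneSpectrum (𝓞 L))) (γl : ∀ v : HeightOneSpectrum (𝓞 L), ValuativeRel.ValueGroupWithZero (v.adicCompletion L))
    (hγ0 : ∀ v ∈ S, γl v ≠ 0) (hγ1 : ∀ v ∈ S, γl v < 1)
    (hχlev : ∀ r : GL (Fin 2) (FiniteAdeleRing (𝓞 L) L), r ∈ glFiniteIntegralLevel 2 L → (∀ v ∈ S, GLn.evalAt 2 L v r ∈ congruenceGL 2 (γl v)) →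
      χ (Matrix.GeneralLinearGroup.det (GLn.ofFinite 2 L r)) = 1)
    (U : Subgroup (HA L e dV hdV dW hdW)) (hUK : ∀ k ∈ 𝒦.K, ∀ u ∈ U, k⁻¹ * u * k ∈ U)
    (s₀ : ℂ) (hfU : ∀ (g : HA L e dV hdV dW hdW), ∀ u ∈ U, f s₀ (g * u) = f s₀ g)
    (hΛU : ∀ r : GL (Fin 2) (FiniteAdeleRing (𝓞 L) L), r ∈ glFiniteIntegralLevel 2 L → (∀ v ∈ S, GLn.evalAt 2 L v r ∈ congruenceGL 2 (γl v)) →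
      Λ (GLn.ofFinite 2 L r) ∈ U) :
    ∃ E₇ : ℂ → HA L e dV hdV dW hdW → ℂ,
      (∀ h : HA L e dV hdV dW hdW, DifferentiableOn ℂ (fun s => E₇ s h) {s : ℂ | 0 < s.re}) ∧
      (∀ s : ℂ, 0 < s.re → Continuous (E₇ s)) ∧
      (∀ (s : ℂ) (h : HA L e dV hdV dW hdW), ((2 : ℕ) : ℝ) / 2 < s.re →
        E₇ s h = (∏ p ∈ ({(1 / 2 : ℂ)} : Finset ℂ), (s - p)) * ∫ u, (β u).toReal •
        (∑' q : ↥(({Quotient.mk (MulAction.orbitRel (siegelDeltaRat L e dV hdV dW hdW) (ratH L e dV hdV dW hdW)) 1} ∪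
            Set.range (fun ν : unipDeltaRat L e dV hdV dW hdW =>
              (Quotient.mk (MulAction.orbitRel (siegelDeltaRat L e dV hdV dW hdW) (ratH L e dV hdV dW hdW)) (wq ν) :
                SiegelDeltaQuot L e dV hdV dW hdW)))ᶜ : Set (SiegelDeltaQuot L e dV hdV dW hdW)),
          f s ((((Quotient.out (q : SiegelDeltaQuot L e dV hdV dW hdW) : ratH L e dV hdV dW hdW) : HA L e dV hdV dW hdW)) *
            ((u : HA L e dV hdV dW hdW) * h))) ∂νN) ∧
      (∀ z : ℂ, 0 < z.re → ∃ C A r : ℝ, 0 < r ∧ ∀ s : ℂ, dist s z < r → ∀ h : HA L e dV hdV dW hdW,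
        ‖E₇ s h‖ ≤ C * adelicHeightGL (2 + 2) L (h : GL (Fin (2 + 2)) (AdeleRing (𝓞 L) L)) ^ A) := by
  haveI : NeZero (2 : ℕ) := ⟨two_ne_zero⟩
  have hf : ∀ s : ℂ, IsSiegelDeltaSection L e dV hdV dW hdW χ s (f s) := hstd.1.1
  -- (b) the untwisting character `ξ = χ·|·|^{½}` and the factor `a = ξ(det ·)⁻¹`
  obtain ⟨ξ, hξ, hξc⟩ := exists_halfNormTwist χ
  obtain ⟨a, ha⟩ : ∃ a : GL (Fin 2) (AdeleRing (𝓞 L) L) → ℂ, ∀ g, a g = (((ξ (Matrix.GeneralLinearGroup.det g))⁻¹ : ℂˣ) : ℂ) := ⟨_, fun g => rfl⟩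
  -- (c) the Iwasawa–Levi coordinate (★ I2) and the factor `b = ξ(det m_x)`
  obtain ⟨mx, kx, C₀, A₀, hC₀, hA₀, hkx, hp, hmx, hmxH⟩ := exists_iwasawaLeviCoordinate L e dV hdV dW hdW 𝒦
  obtain ⟨b, hb⟩ : ∃ b : HA L e dV hdV dW hdW → ℂ, ∀ x, b x = ((ξ (Matrix.GeneralLinearGroup.det (mx x)) : ℂˣ) : ℂ) := ⟨_, fun x => rfl⟩
  -- (d) the untwisted inner family and its Borel laws (§2 over ★ I1), holomorphy (★ (β0-hol))
  obtain ⟨φ, hφ⟩ : ∃ φ : ℂ → HA L e dV hdV dW hdW → GL (Fin 2) (AdeleRing (𝓞 L) L) → ℂ, ∀ s x g, φ s x g = a g * b x * F s (Λ g * kx x) :=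
    ⟨_, fun s x g => rfl⟩
  obtain ⟨hφT, hφN⟩ := innerFamily_laws L e dV hdV dW hdW hg₀ Λ hΛ Γ₀ hΓ₀ hdV0 hdW0 νN hβ₁ χ hχc f hf hcont F hF ξ hξ a ha b kx φ hφ
  have hφhol : ∀ (x : HA L e dV hdV dW hdW) (k : ↥(standardMaximalCompactGL 2 L)), DifferentiableOn ℂ (fun s => φ s x k) {s : ℂ | 0 < s.re} :=
    fun x k => differentiableOn_phi₂ F hFhol a b Λ kx φ hφ x (k : GL (Fin 2) (AdeleRing (𝓞 L) L))
  -- (e) the `W`-package at `K_H := 𝒦.K` (§3: ★ I3 over ★ p862178 and §1)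
  obtain ⟨W, _, hWstab, hWlaw, hWlev, hWcont, hWext, hφW, hφbd⟩ := exists_KTypes_package_of_standard L e dV hdV dW hdW Λ 𝒦 hχ hstd hcont hΛc hΛK ξ hξ hξc a ha
    mx kx hkx hp hmx b hb νN β₁ (iotaGG L e dV hdV dW hdW (1, UnitaryGroup.rationalPairToAdelic (Fp L) L (IsCMField.complexConj L) N M (Matrix.diagonal dV) (Matrix.diagonal dW) g₀))
    F hF hint hFhol φ hφ hφT hφN S γl hχlev U hUK s₀ hfU hΛU
  -- (f) the row section (★ `exists_rowSection₂`) and the identification `hMID`, `c₀ = 1` (★ ED. 3)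
  obtain ⟨γ, hγrow, hγrep⟩ := exists_rowSection₂ (K := L)
  have hξL := xi_det_map_eq_one χ ξ hξ
  have hMID := middleTerm_eq_tsum_untwisted hg₀ Λ hΛ Γ₀ hΓ₀ wq hwq hdV0 hdW0 νN hβ hβtop hK hβK hχ f hf hcont hβ₁ F hF γ hγrow mx kx hp hmx ξ hξL a ha b hb φ hφ
  -- (g) ★ ED. 2 at `n = 2`
  refine exists_middleTerm_package' L e dV hdV dW hdW (n := 2) rfl hdV0 hdW0 S γl hγ0 hγ1 W hWstab hWlaw hWlev hWcont hWext φ hφT hφN hφW hφhol hφbd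
    mx hC₀ hA₀ hmxH γ hγrep νN β wq hχ f hf hcont hβ.measurable hK hβK 1 fun s h hs => hMID s h ?_
  rw [Nat.cast_ofNat] at hs
  linarith

end Summit.HodgeConjecture.HodgeConjecture.Cruxes.HLiu418.K2LiuSiegelEisensteinMiddleTermOfStandard

end
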